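import Mathlib
import HarnessLib
import Literature.Analysis.FluidPDE.SelfSimilar
import Literature.Analysis.FluidPDE.AxisymmetricEuler
import Literature.Analysis.FluidPDE.AxisymmetricVorticityTransport
import Literature.Analysis.FluidPDE.PineauVicolAngularMean
import Literature.Analysis.FluidPDE.KNSSTypeIRateCore
import Literature.Analysis.FluidPDE.KNSSTypeIRateLiouvilleHolds
import Summits.NavierStokesRegularity.NavierStokesRegularity.Theorems.LiouvilleConjectureNS

/-!
# Blow-up scenario census, block A (symmetry annex): the 2.5D and HELICAL ancient cells

Cell `pub/ns-census` (director-ns KEY req102, D-0154 (A), 2026-08-28), typer seat `ns-census-typer-2`.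
Annex to `ScenarioCensusAncient.lean` (block A of `SCENARIO-CENSUS.md` v1.1, rows A7 "2.5D" and A8
"helical", which the census marks NO-VOCAB) answering the ref's flags F5 / F10 (`ns-census-ref`,
TREE-EXCLUSIONS.md §E): the tree DOES speak to two sub-cells of them.

* **A7t** (Type I time-rate · 2.5D = `x₂`-independent three-component field · bounded continuous
  Oseen-mild ancient class): the Liouville step of KNSS 2009 Thm 6.2 — BY NAME the fact
  `KNSS2009_typeI_rate_liouville` (conclusion `W ≡ 0`), discharged in tree. Value: EXCLUDED-IN-TREE.
  (The bounded 2.5D cell WITHOUT the Type-I rate — "u_h = b_h(t), u₃ = b₃(t)" — is the census's A7,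
  EXCLUDED-IN-PRINT-NOT-TREE: the 3D-mild → 2D-weak bridge plus the drift–heat ancient Liouville
  theorem are not typed for that class.)
* **A8v** (helical = invariant under ALL screw motions `x ↦ R_θ x + hθ e₃` of non-zero pitch `h` ·
  SPACE–time Type I envelope `HasTypeIDecay`): VACUOUS — one full turn is the translation by `2πh e₃`,
  so every slice is periodic along the axis, and a periodic function under the envelope
  `C₀/(‖x‖ + √(−t))` vanishes. Proved here in 30 lines (no Navier–Stokes input). The honest open
  helical cell (bounded, or time-only Type I, screw-invariant ancient mild solutions: OPEN-NO-LINE,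
  census A8) is untouched.

No summit statement is proved or claimed here; nothing in this file is a claim about Navier–Stokes
regularity.
-/

noncomputable section

set_option linter.dupNamespace false

open MeasureTheory Set Filter Topology
open scoped ENNReal NNReal

namespace Summit.NavierStokesRegularity.NavierStokesRegularity.Theorems.ScenarioCensus

open Literature.Analysis

/-- Census row A7t — (Type I time-rate `√(−t)‖W‖ ≤ C` · 2.5D: `W(t, x + δe₂) = W(t, x)` · bounded
continuous ancient solution of the Oseen integral equation with weakly divergence-free slices,
`ν = 1`): `W ≡ 0` (KNSS 2009, proof of Thm 6.2: planar Liouville Thm 5.1 for `(w₁, w₃)`, Remark 6.1,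
caloric Liouville for `w₂`), BY NAME the fact `KNSS2009_typeI_rate_liouville`. Value: EXCLUDED-IN-TREE. -/
def Row_A7t : Prop :=
  FluidPDE.KNSS2009_typeI_rate_liouville

/-- A7t is EXCLUDED-IN-TREE: `KNSS2009_typeI_rate_liouville_holds`. -/
theorem row_A7t_excluded : Row_A7t :=
  FluidPDE.KNSS2009_typeI_rate_liouville_holds

/-- Census row A8v — (any type with the SPACE–time Type I envelope `‖u(t,x)‖ ≤ C₀/(‖x‖ + √(−t))` ·
HELICAL: `u(t, R_θ x + hθ e₃) = R_θ u(t, x)` for all `θ`, all `t < 0`, pitch `h ≠ 0` · any field):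
`u(t, x) = 0` for all `t < 0`, `x` — the cell is EMPTY (symmetry incompatible with spatial decay), no
equation used. Value: EXCLUDED-IN-TREE (vacuous), proved below. -/
def Row_A8v : Prop :=
  ∀ h : ℝ, h ≠ 0 → ∀ u : ℝ → EuclideanSpace ℝ (Fin 3) → EuclideanSpace ℝ (Fin 3),
    (∀ t < 0, ∀ (θ : ℝ) (x : EuclideanSpace ℝ (Fin 3)),
        u t (FluidPDE.rotZ θ x + (h * θ) • EuclideanSpace.single 2 (1 : ℝ)) =
          FluidPDE.rotZ θ (u t x)) →
      (∃ C₀ : ℝ, FluidPDE.HasTypeIDecay C₀ u) → ∀ t < 0, ∀ x, u t x = 0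

/-- Full turns are the identity: `R_{2πn} = id` for `n : ℕ` (from `rotZ_add_two_pi`). -/
theorem rotZ_two_pi_mul_nat (n : ℕ) (y : EuclideanSpace ℝ (Fin 3)) :
    FluidPDE.rotZ (2 * Real.pi * n) y = y := by
  induction n with
  | zero => simp [FluidPDE.rotZ_zero]
  | succ k ih =>
    have : 2 * Real.pi * ((k + 1 : ℕ) : ℝ) = 2 * Real.pi * k + 2 * Real.pi := by push_cast; ring
    rw [this, FluidPDE.rotZ_add_two_pi, ih]

/-- A8v is EXCLUDED-IN-TREE (vacuous cell): screw invariance with `θ = 2πn` is invariance under the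
translations `x ↦ x + 2πnh e₃`; along them the Type I envelope tends to `0`, so `‖u(t,x)‖ ≤ 0`. -/
theorem row_A8v_excluded : Row_A8v := by
  intro h hh u hscrew hdec t ht x
  obtain ⟨C₀, hC⟩ := hdec
  set e : EuclideanSpace ℝ (Fin 3) := EuclideanSpace.single 2 (1 : ℝ) with he
  have he1 : ‖e‖ = 1 := by simp [he]
  -- periodicity along the axis: one full turn of the screw is the translation by `2πh e₃`
  have hper : ∀ n : ℕ, u t (x + (h * (2 * Real.pi * n)) • e) = u t x := by
    intro n
    have := hscrew t ht (2 * Real.pi * n) x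
    rwa [rotZ_two_pi_mul_nat, rotZ_two_pi_mul_nat] at this
  have hbound : ∀ n : ℕ,
      ‖u t x‖ ≤ C₀ / (‖x + (h * (2 * Real.pi * n)) • e‖ + Real.sqrt (-t)) := by
    intro n
    rw [← hper n]
    exact hC t ht _
  -- the denominators tend to `+∞` along the translates
  have hlow : ∀ n : ℕ, 2 * Real.pi * |h| * n - ‖x‖ + Real.sqrt (-t) ≤
      ‖x + (h * (2 * Real.pi * n)) • e‖ + Real.sqrt (-t) := by
    intro n
    have h1 : ‖(h * (2 * Real.pi * n)) • e‖ ≤ ‖x + (h * (2 * Real.pi * n)) • e‖ + ‖x‖ := by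
      calc ‖(h * (2 * Real.pi * n)) • e‖ = ‖(x + (h * (2 * Real.pi * n)) • e) - x‖ := by
            rw [add_sub_cancel_left]
        _ ≤ ‖x + (h * (2 * Real.pi * n)) • e‖ + ‖x‖ := norm_sub_le _ _
    have h2 : ‖(h * (2 * Real.pi * n)) • e‖ = 2 * Real.pi * |h| * n := by
      rw [norm_smul, he1, mul_one, Real.norm_eq_abs, abs_mul,
        abs_of_nonneg (by positivity : (0 : ℝ) ≤ 2 * Real.pi * n)]
      ring
    linarith
  have htop : Tendsto (fun n : ℕ => ‖x + (h * (2 * Real.pi * n)) • e‖ + Real.sqrt (-t))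
      atTop atTop := by
    refine tendsto_atTop_mono hlow ?_
    have ha : 0 < 2 * Real.pi * |h| := mul_pos (by positivity) (abs_pos.2 hh)
    have h1 : Tendsto (fun n : ℕ => 2 * Real.pi * |h| * (n : ℝ)) atTop atTop :=
      Tendsto.const_mul_atTop ha tendsto_natCast_atTop_atTop
    have h2 := tendsto_atTop_add_const_right atTop (-‖x‖ + Real.sqrt (-t)) h1
    exact h2.congr fun n => by ring
  have hlim : Tendsto (fun n : ℕ => C₀ / (‖x + (h * (2 * Real.pi * n)) • e‖ + Real.sqrt (-t)))
      atTop (𝓝 0) :=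
    tendsto_const_nhds.div_atTop htop
  exact norm_le_zero_iff.1 (ge_of_tendsto' hlim hbound)

/-! ## Appendix 1 (append-only round 2): the OPEN helical ancient cells A8 / A8t as typed targets

Helical symmetry needs no new predicate: it is written inline as invariance under all screw motions
`x ↦ R_θ x + hθ e₃` (`FluidPDE.rotZ`, pitch `h ≠ 0`). CAVEAT fixing the conclusion: the duality-form
ancient mild class does not see spatially constant time-dependent fields (cf.
`FluidPDE.isBoundedAncientMildSolution_timeConst`), and `u(t,x) = (C/√(−t)) e₃` is screw-invariant with
time-Type-I decay; so the helical Liouville rows conclude "every slice is a.e. CONSTANT" (as (L) does),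
not "u ≡ 0". Both rows are special cases of A1 = leaf `LiouvilleConjectureNS` (proved below). -/

/-- Census row A8 — (any bounded type · HELICAL, pitch `h ≠ 0` · bounded ancient mild, measurable
slices): every slice is a.e. constant. The KNSS-type helical Liouville problem (no printed theorem known
to the cell; wave-2 candidate §5 #4). Value: OPEN-NO-LINE; implied by A1
(`row_A8_of_liouvilleConjectureNS`; Row_A1 of `ScenarioCensusAncient.lean` is that leaf by `rfl`). -/
def Row_A8 : Prop :=
  ∀ h : ℝ, h ≠ 0 → ∀ u : ℝ → EuclideanSpace ℝ (Fin 3) → EuclideanSpace ℝ (Fin 3),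
    FluidPDE.IsBoundedAncientMildSolution 1 u → (∀ t < 0, AEStronglyMeasurable (u t) volume) →
      (∀ t < 0, ∀ (θ : ℝ) (x : EuclideanSpace ℝ (Fin 3)),
          u t (FluidPDE.rotZ θ x + (h * θ) • EuclideanSpace.single 2 (1 : ℝ)) =
            FluidPDE.rotZ θ (u t x)) →
        ∀ t < 0, ∃ b : EuclideanSpace ℝ (Fin 3), u t =ᵐ[volume] fun _ => b

/-- A1 ⇒ A8 (the helical hypothesis is carried, not used). -/
theorem row_A8_of_liouvilleConjectureNS
    (hL : Summit.NavierStokesRegularity.NavierStokesRegularity.LiouvilleConjectureNS) : Row_A8 :=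
  fun _ _ u hu hmeas _ => hL u hu hmeas

/-- Census row A8t — (TIME-only Type I `‖u(t,x)‖ ≤ C/√(−t)` · HELICAL, pitch `h ≠ 0` · ancient mild,
measurable slices, not assumed bounded up to `t = 0`): every slice is a.e. constant (the census's
"time-Type-I helical" sub-cell of A8 / R8; see the caveat above for why not "≡ 0"). Value: OPEN-NO-LINE;
implied by A1 (`row_A8t_of_liouvilleConjectureNS`, by a time shift making the solution bounded). -/
def Row_A8t : Prop :=
  ∀ h : ℝ, h ≠ 0 → ∀ u : ℝ → EuclideanSpace ℝ (Fin 3) → EuclideanSpace ℝ (Fin 3),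
    FluidPDE.IsAncientMildSolution 1 u → (∀ t < 0, AEStronglyMeasurable (u t) volume) →
      (∀ t < 0, ∀ (θ : ℝ) (x : EuclideanSpace ℝ (Fin 3)),
          u t (FluidPDE.rotZ θ x + (h * θ) • EuclideanSpace.single 2 (1 : ℝ)) =
            FluidPDE.rotZ θ (u t x)) →
        (∃ C : ℝ, FluidPDE.HasTypeITimeDecay C u) →
          ∀ t < 0, ∃ b : EuclideanSpace ℝ (Fin 3), u t =ᵐ[volume] fun _ => b

/-- A1 ⇒ A8t: the time-shifted field `v(τ) = u(τ + t/2)` is a BOUNDED ancient mild solution (bound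
`C/√(−t/2)`), to which (L) applies at `τ = t/2`. The helical hypothesis is carried, not used. -/
theorem row_A8t_of_liouvilleConjectureNS
    (hL : Summit.NavierStokesRegularity.NavierStokesRegularity.LiouvilleConjectureNS) : Row_A8t := by
  intro h _ u hu hmeas _ hdec t ht
  obtain ⟨C, hC⟩ := hdec
  set s : ℝ := t / 2 with hs_def
  have hs : s < 0 := by rw [hs_def]; linarith
  have hsqrt : 0 < Real.sqrt (-s) := Real.sqrt_pos.2 (by linarith)
  have hC0 : 0 ≤ C := by
    have h0 := (norm_nonneg _).trans (hC s hs 0)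
    rwa [le_div_iff₀ hsqrt, zero_mul] at h0
  set v : ℝ → EuclideanSpace ℝ (Fin 3) → EuclideanSpace ℝ (Fin 3) := fun τ => u (τ + s) with hv_def
  have hv : FluidPDE.IsBoundedAncientMildSolution 1 v := by
    refine ⟨hu.time_translate hs.le, C / Real.sqrt (-s), fun τ hτ x => ?_⟩
    have hτ' : τ < 0 := mem_Iio.1 hτ
    have h1 := hC (τ + s) (by linarith) x
    have h2 : Real.sqrt (-s) ≤ Real.sqrt (-(τ + s)) := Real.sqrt_le_sqrt (by linarith)
    exact h1.trans (div_le_div_of_nonneg_left hC0 hsqrt h2)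
  have hvmeas : ∀ τ < 0, AEStronglyMeasurable (v τ) volume := fun τ hτ => hmeas (τ + s) (by linarith)
  obtain ⟨b, hb⟩ := hL v hv hvmeas (t - s) (by rw [hs_def]; linarith)
  refine ⟨b, ?_⟩
  have : v (t - s) = u t := by simp [hv_def]
  rw [this] at hb
  exact hb

/-! ## Appendix 2 (append-only round 3): census v1.4 row A2b′ — time-only Type I × axisymmetric WITH swirl

Census v1.4 (lead, after ref flag F2) splits the axisymmetric Type-I ancient cell: A2b (space–time envelope
`HasTypeIDecay`, EXCLUDED) versus A2b′ (TIME-only rate `‖u(t,x)‖ ≤ C/√(−t)`, OPEN — KNSS Thm 6.2 needs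
`r‖u‖ ≤ C` in addition, = A4). As for A8t the duality-form class forces the conclusion "slices a.e. equal to
an AXIAL constant `β(t) e_z`" (a spatially constant `b(t)` with `|b| ≤ C/√(−t)` is in the class, and
axisymmetry forces `b ∥ e_z`), not "u ≡ 0". -/

/-- An axisymmetric field which is a.e. equal to a constant `b` has `b` on the axis: `b = β e_z`
(rotate by `π`: Lebesgue measure is invariant, so `b = R_π b`, killing the horizontal components). -/
theorem exists_eq_smul_eZ_of_isAxisymmetric_of_ae_eq_const
    {v : EuclideanSpace ℝ (Fin 3) → EuclideanSpace ℝ (Fin 3)} {b : EuclideanSpace ℝ (Fin 3)}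
    (haxi : FluidPDE.IsAxisymmetric v) (hb : v =ᵐ[volume] fun _ => b) :
    ∃ β : ℝ, b = β • FluidPDE.eZ := by
  have h1 : (fun x => v (FluidPDE.rotZ Real.pi x)) =ᵐ[volume] fun _ => b := by
    have := ((FluidPDE.rotZLIE Real.pi).measurePreserving).quasiMeasurePreserving.ae_eq_comp hb
    simpa [Function.comp_def] using this
  have h2 : (fun x => v (FluidPDE.rotZ Real.pi x)) =ᵐ[volume] fun _ => FluidPDE.rotZ Real.pi b := by
    filter_upwards [hb] with x hx
    rw [haxi Real.pi x, hx]
  have h3 : ∀ᵐ _ : EuclideanSpace ℝ (Fin 3) ∂volume, b = FluidPDE.rotZ Real.pi b := by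
    filter_upwards [h1, h2] with x h1x h2x
    exact h1x.symm.trans h2x
  haveI : (ae (volume : Measure (EuclideanSpace ℝ (Fin 3)))).NeBot := ae_neBot.2 (NeZero.ne _)
  have hfix : b = FluidPDE.rotZ Real.pi b := Filter.eventually_const.1 h3
  have hb0 : b 0 = 0 := by
    have := congrFun (congrArg (⇑) hfix) 0
    simp [FluidPDE.rotZ_apply_zero, Real.cos_pi, Real.sin_pi] at this
    linarith
  have hb1 : b 1 = 0 := by
    have := congrFun (congrArg (⇑) hfix) 1
    simp [FluidPDE.rotZ_apply_one, Real.cos_pi, Real.sin_pi] at this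
    linarith
  refine ⟨b 2, ?_⟩
  ext i
  fin_cases i <;> simp [FluidPDE.eZ, hb0, hb1]

/-- Census row A2b′ (v1.4; Lean name `Row_A2b'`) — (TIME-only Type I `‖u(t,x)‖ ≤ C/√(−t)` · axisymmetric,
swirl ALLOWED, at every `t < 0` · ancient mild `ν = 1`, measurable slices): every slice is a.e. an axial
constant `β(t) e_z`. Value: OPEN (inherited lines only, census §5 #2′); with `r‖u‖ ≤ C` added it is A4
(EXCLUDED), with the space–time envelope it is A2b (EXCLUDED); implied by A1
(`row_A2b'_of_liouvilleConjectureNS`). -/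
def Row_A2b' : Prop :=
  ∀ u : ℝ → EuclideanSpace ℝ (Fin 3) → EuclideanSpace ℝ (Fin 3), FluidPDE.IsAncientMildSolution 1 u →
    (∀ t < 0, AEStronglyMeasurable (u t) volume) → (∀ t < 0, FluidPDE.IsAxisymmetric (u t)) →
      (∃ C : ℝ, FluidPDE.HasTypeITimeDecay C u) →
        ∀ t < 0, ∃ β : ℝ, u t =ᵐ[volume] fun _ => β • FluidPDE.eZ

/-- A1 ⇒ A2b′: shift time so that the solution is bounded, apply (L) to get a constant slice, and put
the constant on the axis by `exists_eq_smul_eZ_of_isAxisymmetric_of_ae_eq_const`. -/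
theorem row_A2b'_of_liouvilleConjectureNS
    (hL : Summit.NavierStokesRegularity.NavierStokesRegularity.LiouvilleConjectureNS) : Row_A2b' := by
  intro u hu hmeas haxi hdec t ht
  obtain ⟨C, hC⟩ := hdec
  set s : ℝ := t / 2 with hs_def
  have hs : s < 0 := by rw [hs_def]; linarith
  have hsqrt : 0 < Real.sqrt (-s) := Real.sqrt_pos.2 (by linarith)
  have hC0 : 0 ≤ C := by
    have h0 := (norm_nonneg _).trans (hC s hs 0)
    rwa [le_div_iff₀ hsqrt, zero_mul] at h0
  set v : ℝ → EuclideanSpace ℝ (Fin 3) → EuclideanSpace ℝ (Fin 3) := fun τ => u (τ + s) with hv_def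
  have hv : FluidPDE.IsBoundedAncientMildSolution 1 v := by
    refine ⟨hu.time_translate hs.le, C / Real.sqrt (-s), fun τ hτ x => ?_⟩
    have hτ' : τ < 0 := mem_Iio.1 hτ
    have h1 := hC (τ + s) (by linarith) x
    have h2 : Real.sqrt (-s) ≤ Real.sqrt (-(τ + s)) := Real.sqrt_le_sqrt (by linarith)
    exact h1.trans (div_le_div_of_nonneg_left hC0 hsqrt h2)
  have hvmeas : ∀ τ < 0, AEStronglyMeasurable (v τ) volume := fun τ hτ => hmeas (τ + s) (by linarith)
  obtain ⟨b, hb⟩ := hL v hv hvmeas (t - s) (by rw [hs_def]; linarith)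
  have hvt : v (t - s) = u t := by simp [hv_def]
  rw [hvt] at hb
  obtain ⟨β, rfl⟩ := exists_eq_smul_eZ_of_isAxisymmetric_of_ae_eq_const (haxi t ht) hb
  exact ⟨β, hb⟩

/-! ## Appendix 3 (append-only round 4): census row A7 — bounded 2.5D ancient solutions (typed, in print) -/

/-- Census row A7 — (any bounded type · 2.5D: `u(t, x + δ e₃) = u(t, x)` for all `δ` (independent of
`x₃`, three components) · bounded ancient mild `ν = 1`, measurable slices): every slice is a.e. constant
(in print: KNSS 2009 Thm 5.1 for `(u₁,u₂)` plus the ancient drift–heat Liouville theorem for `u₃`; the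
3D-mild → 2D-weak bridge is not in the tree for this class — its Type-I-rate twin A7t is). No `_excluded`
theorem: value EXCLUDED-IN-PRINT-NOT-TREE; special case of A1 (`row_A7_of_liouvilleConjectureNS`). -/
def Row_A7 : Prop :=
  ∀ u : ℝ → EuclideanSpace ℝ (Fin 3) → EuclideanSpace ℝ (Fin 3),
    FluidPDE.IsBoundedAncientMildSolution 1 u → (∀ t < 0, AEStronglyMeasurable (u t) volume) →
      (∀ t < 0, ∀ (x : EuclideanSpace ℝ (Fin 3)) (δ : ℝ),
          u t (x + δ • EuclideanSpace.single 2 (1 : ℝ)) = u t x) →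
        ∀ t < 0, ∃ b : EuclideanSpace ℝ (Fin 3), u t =ᵐ[volume] fun _ => b

/-- A1 ⇒ A7 (the 2.5D hypothesis is carried, not used). -/
theorem row_A7_of_liouvilleConjectureNS
    (hL : Summit.NavierStokesRegularity.NavierStokesRegularity.LiouvilleConjectureNS) : Row_A7 :=
  fun u hu hmeas _ => hL u hu hmeas

/-! ## Appendix 4 (append-only round 5): the open half of census R8 — helical (R)DSS, time-only Type I

Census v1.7 row R8 is composite: its self-similar / RSS part is EXCLUDED-IN-TREE (`Row_R8` of
`ScenarioCensusRotating.lean`, ≡ `Theorems.rssStratum_helical`) and its λ-DSS part under the space–time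
envelope `HasTypeIDecay` is VACUOUS (`Row_A8v` above), while "helical (R)DSS with TIME-only Type I"
was OPEN-NO-LINE with no typed statement ("no vocabulary beyond binders"). It is typed here, next to
its ancient parents A8 / A8t, with the SHARP conclusion the symmetry allows: a helically symmetric
slice which is a.e. constant is a.e. an AXIAL constant `β e_z` (compose the a.e. identity with the
measure-preserving half-turn screw `x ↦ R_π x + πh e₃`; lemma
`exists_eq_smul_eZ_of_helical_of_ae_eq_const`, the helical twin of
`exists_eq_smul_eZ_of_isAxisymmetric_of_ae_eq_const`). The (R)DSS hypothesis is carried, not used: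
R8t ⇐ A8t ⇐ A1. -/

/-- The screw motion `x ↦ R_θ x + s e₃` preserves Lebesgue measure (rotation, then translation). -/
theorem measurePreserving_screw (θ s : ℝ) :
    MeasurePreserving
      (fun x : EuclideanSpace ℝ (Fin 3) => FluidPDE.rotZ θ x + s • EuclideanSpace.single 2 (1 : ℝ))
      volume volume :=
  (measurePreserving_add_right (volume : Measure (EuclideanSpace ℝ (Fin 3)))
      (s • EuclideanSpace.single 2 (1 : ℝ))).comp (FluidPDE.rotZLIE θ).measurePreserving

/-- A helically symmetric field (pitch `h`, any value) which is a.e. equal to a constant `b` has `b`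
on the axis: `b = β e_z` (the half-turn screw preserves Lebesgue measure, so `b = R_π b`). -/
theorem exists_eq_smul_eZ_of_helical_of_ae_eq_const {h : ℝ}
    {v : EuclideanSpace ℝ (Fin 3) → EuclideanSpace ℝ (Fin 3)} {b : EuclideanSpace ℝ (Fin 3)}
    (hscrew : ∀ (θ : ℝ) (x : EuclideanSpace ℝ (Fin 3)),
      v (FluidPDE.rotZ θ x + (h * θ) • EuclideanSpace.single 2 (1 : ℝ)) = FluidPDE.rotZ θ (v x))
    (hb : v =ᵐ[volume] fun _ => b) :
    ∃ β : ℝ, b = β • FluidPDE.eZ := by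
  have h1 : (fun x => v (FluidPDE.rotZ Real.pi x + (h * Real.pi) • EuclideanSpace.single 2 (1 : ℝ)))
      =ᵐ[volume] fun _ => b :=
    (measurePreserving_screw Real.pi (h * Real.pi)).quasiMeasurePreserving.ae_eq_comp hb
  have h2 : (fun x => v (FluidPDE.rotZ Real.pi x + (h * Real.pi) • EuclideanSpace.single 2 (1 : ℝ)))
      =ᵐ[volume] fun _ => FluidPDE.rotZ Real.pi b := by
    filter_upwards [hb] with x hx
    rw [hscrew Real.pi x, hx]
  have h3 : ∀ᵐ _ : EuclideanSpace ℝ (Fin 3) ∂volume, b = FluidPDE.rotZ Real.pi b := by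
    filter_upwards [h1, h2] with x h1x h2x
    exact h1x.symm.trans h2x
  haveI : (ae (volume : Measure (EuclideanSpace ℝ (Fin 3)))).NeBot := ae_neBot.2 (NeZero.ne _)
  have hfix : b = FluidPDE.rotZ Real.pi b := Filter.eventually_const.1 h3
  have hb0 : b 0 = 0 := by
    have := congrFun (congrArg (⇑) hfix) 0
    simp [FluidPDE.rotZ_apply_zero, Real.cos_pi, Real.sin_pi] at this
    linarith
  have hb1 : b 1 = 0 := by
    have := congrFun (congrArg (⇑) hfix) 1
    simp [FluidPDE.rotZ_apply_one, Real.cos_pi, Real.sin_pi] at this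
    linarith
  refine ⟨b 2, ?_⟩
  ext i
  fin_cases i <;> simp [FluidPDE.eZ, hb0, hb1]

/-- Census row R8t — (TIME-only Type I `‖u(t,x)‖ ≤ C/√(−t)` · HELICAL, pitch `h ≠ 0` · rotated
discretely self-similar with ANY factor `c > 1` and ANY linear isometry `R` (`IsRotatedDSS c R u`;
`R = 1` is λ-DSS) · ancient mild `ν = 1`, measurable slices): every slice is a.e. an AXIAL constant
`β(t) e_z`. This is the open half of the composite census row R8 ("helical DSS with time-only Type I";
its RSS half is `Row_R8`, its space–time-Type-I half is the vacuous `Row_A8v`); the example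
`u(t,x) = (C/√(−t)) e₃` (self-similar, screw-invariant, in the duality-form class) shows the conclusion
cannot be `u ≡ 0`. Value: OPEN-NO-LINE (typed target); implied by A8t, hence by A1
(`row_R8t_of_row_A8t`, `row_R8t_of_liouvilleConjectureNS`) — the self-similarity is carried, not used. -/
def Row_R8t : Prop :=
  ∀ h : ℝ, h ≠ 0 → ∀ (c : ℝ), 1 < c →
    ∀ (R : EuclideanSpace ℝ (Fin 3) ≃ₗᵢ[ℝ] EuclideanSpace ℝ (Fin 3))
      (u : ℝ → EuclideanSpace ℝ (Fin 3) → EuclideanSpace ℝ (Fin 3)),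
      FluidPDE.IsAncientMildSolution 1 u → (∀ t < 0, AEStronglyMeasurable (u t) volume) →
        FluidPDE.IsRotatedDSS c R u →
        (∀ t < 0, ∀ (θ : ℝ) (x : EuclideanSpace ℝ (Fin 3)),
            u t (FluidPDE.rotZ θ x + (h * θ) • EuclideanSpace.single 2 (1 : ℝ)) =
              FluidPDE.rotZ θ (u t x)) →
          (∃ C : ℝ, FluidPDE.HasTypeITimeDecay C u) →
            ∀ t < 0, ∃ β : ℝ, u t =ᵐ[volume] fun _ => β • FluidPDE.eZ

/-- A8t ⇒ R8t: drop the self-similarity, get an a.e. constant slice from A8t, and put the constant on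
the axis by `exists_eq_smul_eZ_of_helical_of_ae_eq_const`. -/
theorem row_R8t_of_row_A8t (hA : Row_A8t) : Row_R8t := by
  intro h hh c _ R u hu hmeas _ hscrew hdec t ht
  obtain ⟨b, hb⟩ := hA h hh u hu hmeas hscrew hdec t ht
  obtain ⟨β, rfl⟩ := exists_eq_smul_eZ_of_helical_of_ae_eq_const (hscrew t ht) hb
  exact ⟨β, hb⟩

/-- A1 ⇒ R8t (through A8t). -/
theorem row_R8t_of_liouvilleConjectureNS
    (hL : Summit.NavierStokesRegularity.NavierStokesRegularity.LiouvilleConjectureNS) : Row_R8t :=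
  row_R8t_of_row_A8t (row_A8t_of_liouvilleConjectureNS hL)

/-- The same sharpening for the parent rows: under A8t (hence under A1) a time-Type-I helical ancient
mild solution has AXIAL a.e. constant slices `β(t) e_z` — the form in which the helical Liouville
target should be quoted (census §5 #4). -/
theorem helical_slices_axial_of_row_A8t (hA : Row_A8t) :
    ∀ h : ℝ, h ≠ 0 → ∀ u : ℝ → EuclideanSpace ℝ (Fin 3) → EuclideanSpace ℝ (Fin 3),
      FluidPDE.IsAncientMildSolution 1 u → (∀ t < 0, AEStronglyMeasurable (u t) volume) →
        (∀ t < 0, ∀ (θ : ℝ) (x : EuclideanSpace ℝ (Fin 3)),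
            u t (FluidPDE.rotZ θ x + (h * θ) • EuclideanSpace.single 2 (1 : ℝ)) =
              FluidPDE.rotZ θ (u t x)) →
          (∃ C : ℝ, FluidPDE.HasTypeITimeDecay C u) →
            ∀ t < 0, ∃ β : ℝ, u t =ᵐ[volume] fun _ => β • FluidPDE.eZ := by
  intro h hh u hu hmeas hscrew hdec t ht
  obtain ⟨b, hb⟩ := hA h hh u hu hmeas hscrew hdec t ht
  obtain ⟨β, rfl⟩ := exists_eq_smul_eZ_of_helical_of_ae_eq_const (hscrew t ht) hb
  exact ⟨β, hb⟩

end Summit.NavierStokesRegularity.NavierStokesRegularity.Theorems.ScenarioCensus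

end
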